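import Summits.HodgeConjecture.HodgeConjecture.Theorems.R90S8ResGMidBlockLeResidualOfRecordV4U3        -- ★ p865357 (K2E2-p12 (g10)): (R)′τ OF RECORD ED. 4 `resGMidBlockτ_le_residual_of_record_v4` — re-point to ED. 5 when it lands (frame preamble is edition-stable)
import Summits.HodgeConjecture.HodgeConjecture.Theorems.K2E1SphericalEisensteinStructuralDataCMThree   -- ★ (K2E1): `exists_haar_coveringWeight_unfoldedMeasure_cm_three` (νG β μZ cluster), `exists_unipotent_haar_fundamentalDomain_cm_three` (Heisenberg νE 𝓕E cluster)
import HarnessLib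

/-!
# S8 sub-socket (R)′ — `R90S8ResGMidBlockLeResidualOfRecordFramedU3`: (R)′τ OF RECORD (ED. 4), FRAMED — the 28 free structural binders of ★ `resGMidBlockτ_le_residual_of_record_v4`
# discharged in-file (W12 = the (R)′ twin of ★ W0 `resGMidBlock_ne_bot_of_record_framed`)

Track B ∕ R90-TF, crux h413 = `stmt-HodgeConjecture-24833`, route of record `HCCMUnconditional`; cell `hodgecm-mathlib`, R90-TF section S8 «ContSpec-n½», sub-socket (R)′ (B ED. 7
:337).  Walk-in hand R90-C131-p03 (g3) (chair VALVE 43 → S8 dealer R90-CS-plan (g4) S8-R293 (1) «W12 = THE (R)′ FRAME PACK», typ2 (g4) PROBE v3.1 §(b) «an (R)′ frame pack would be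
W0's twin»; dischargers certified in typ2's FRAME LEDGER `R90/R90-CS-typ2/g4/FRAME_LEDGER_names.typ2-g4.lean`).  THEOREMS ONLY (no `def`, no `instance`, no `notation`, no named-fact
hypothesis, no `sorry`; default heartbeats); lane `--supports stmt-HodgeConjecture-24833 --as helper` (count-neutral).  CLOSES NO SOCKET and PAYS NO LETTER: it shortens the binder list
of the (R)′τ OF RECORD head for the keeper's next edition and for B's :337 payment line; (R)′τ stays ★ OF RECORD modulo {`hDISC` (L1), the F5 rows, `hμu hquad`, the per-section
letters `hUNF hunfK hOFFBD`}.

THE FRAME PACK (the 28 riders of ★ ED. 4, discharged exactly as ★ W0 discharges the (V) head's): (F1′) the Borel σ-algebras of `G_∞`, `G_f` and the ideles (`borel _`, `⟨rfl⟩`)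
— 6 instance binders, none of which is mentioned by a riding letter once `μa μf` are chosen in-file; (F3) the `G`-side structural cluster `νG [Haar] [InvInv] [SFinite] β hβ μZ [SFinite]
hμZ` — ONE `obtain` from ★ `exists_haar_coveringWeight_unfoldedMeasure_cm_three`; (F4) the HEISENBERG cluster `νE [Haar] [RightInv] [InvInv] 𝓕E h𝓕EN h𝓕Ec h𝓕E0` — ONE `obtain` from ★
`exists_unipotent_haar_fundamentalDomain_cm_three` (here, unlike in the (V) head, the unipotent Haar measure and its fundamental domain are PURE FRAME: the riding letters `hUNF hunfK
hOFFBD` quantify their own `ν 𝓕`); (F5∕F6) the port Haar measures `μa` (Mathlib `Measure.haar`; unimodular by ★ `isMulRightInvariant_of_modularCharacterFun_eq_one` ∘ ★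
`modularCharacterFun_arch_eq_one` at the antidiagonal form [Rogawski1990 §14.2]) and `μf` (`Measure.haar`, ★ `locallyCompactSpace_finAdelic`).  What RIDES: the σ-algebra of `G(𝔸)`
(the per-section letters' `ν` lives on its unipotent subgroup); B's frame `μ 𝔓 h𝔓 hne μω hμu hquad ξ`; `hDISC`; the F5 scalar rows `hS hurφ hT' hurη q qc hqcq hPcd hqa A hA hsrc hA32`;
the per-section letters `hUNF hunfK hOFFBD` — ★ ED. 4's bytes, token for token.
* **`resGMidBlockτ_le_residual_of_record_framed`** — ED. 4's conclusion `resGMidBlockτ L μ ξ μω ≤ L²_res(𝔓)` from the riding binders only.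
HONEST LABEL: HC_CM is proved only modulo the 7 printed citations (2 remaining named inputs: hLiu418 = `stmt-HodgeConjecture-24832`, h413 = `stmt-HodgeConjecture-24833`) until
rung 0 closes; REL ≠ ★ ≠ BUILT; frame plumbing, no letter paid, no socket closed; count-neutral.

## References
* [MoeglinWaldspurger1995] C. Mœglin, J.-L. Waldspurger, *Spectral Decomposition and Eisenstein Series* (1995), I.2.17–I.2.18, IV.1.9–IV.1.11, IV.2.3, V.3.13.
* [Rogawski1990] J. D. Rogawski, *Automorphic Representations of Unitary Groups in Three Variables* (1990), §13.9 p. 229 (ii), §14.2 p. 232.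
* [WeilIntegration1965] A. Weil, *L'intégration dans les groupes topologiques et ses applications* (2ᵉ éd., 1965), §9.
-/

set_option autoImplicit false
set_option linter.dupNamespace false  -- the mandated namespace `…HodgeConjecture.HodgeConjecture.R90.S8` (LEAD #1 L1) repeats the summit's segment

noncomputable section

open MeasureTheory Measure NumberField IsDedekindDomain Set Filter Topology ContRepresentation Complex
open scoped ENNReal NNReal ComplexConjugate InnerProductSpace Topology
open Literature.NumberTheory Literature.NumberTheory.Automorphic Literature.NumberTheory.Automorphic.UnitaryGroup Literature.NumberTheory.GaloisRepresentations AdelicGroupData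
open Literature.NumberTheory.Automorphic.Arthur2013.Leaves.TECR Literature.NumberTheory.Rogawski1990 Literature.NumberTheory.LFunctions Literature.MeasureTheory.Group
open Literature.RepresentationTheory.CompactGroups
open Summit.HodgeConjecture.HodgeConjecture.Cruxes.H413.K2E1BorelEisensteinU Summit.HodgeConjecture.HodgeConjecture.Cruxes.H413.K2E1CharacterEisensteinU2Defs
open Summit.HodgeConjecture.HodgeConjecture.Cruxes.H413.K2E1CharacterEisensteinU3PairDefs Summit.HodgeConjecture.HodgeConjecture.Cruxes.H413.K2E1ChiSectionSpaceU3PairDefs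
open Summit.HodgeConjecture.HodgeConjecture.Cruxes.H413.K2E1BLBorelSpacesU2Defs Summit.HodgeConjecture.HodgeConjecture.Cruxes.H413.K2E1BLBorelOperatorsU2Defs
open Summit.HodgeConjecture.HodgeConjecture.Cruxes.H413.K2E1CuspidalSpectrumUnitary (residualSubspace)
open Summit.HodgeConjecture.HodgeConjecture.Cruxes.H413.R90S8ResGMidBlockScatteringOfRecordU3 (integrable_restrict_mul_conj_of_bounded)
open Summit.HodgeConjecture.HodgeConjecture.Cruxes.H413.K2E1ChiAxisRealityOfRecordCMThree (im_wc_eq_zero_of_exports_free)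
open Summit.HodgeConjecture.HodgeConjecture.Cruxes.H413.K2E1ChiMaassSelbergOnAxisScalarsOfRecordCMThree (exists_scalars_of_coords_global exists_eventually_norm_kernelDiag_le_of_coords eventually_im_eq_zero_of_real_offPoles)
open Summit.HodgeConjecture.HodgeConjecture.Cruxes.H413.K2E1SphericalEisensteinStructuralDataCMThree (exists_haar_coveringWeight_unfoldedMeasure_cm_three exists_unipotent_haar_fundamentalDomain_cm_three)

namespace Summit.HodgeConjecture.HodgeConjecture.R90.S8

variable (L : Type) [Field L] [NumberField L] [IsCMField L] [MeasurableSpace (quasiSplit (↥(maximalRealSubfield L)) L (IsCMField.complexConj L) 3).Adelic] [BorelSpace (quasiSplit (↥(maximalRealSubfield L)) L (IsCMField.complexConj L) 3).Adelic]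

/-- **(R)′τ OF RECORD, ED. 4 FRAMED — `resGMidBlockτ ξ μω ≤ L²_res(𝔓)`** from the RIDING binders only: B's frame `μ 𝔓 h𝔓 hne μω hμu hquad ξ`; the `K_max`-admissibility letter
`hDISC` (L1); the F5 scalar rows `hS hurφ hT' hurη q qc hqcq hPcd hqa A hA hsrc hA32`; the per-section letters `hUNF` (unfolding), `hunfK` (Euler factorisation on `K_max`), `hOFFBD`
(off-axis boundedness) — all ★ ED. 4's bytes.  The 28 FREE frame binders of ★ `resGMidBlockτ_le_residual_of_record_v4` (σ-algebras of `G_∞ G_f` and the ideles; `νG β μZ`; the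
Heisenberg `νE 𝓕E`; the port Haar measures `μa μf`) are discharged inside (module doc). [cite: MoeglinWaldspurger1995, IV.1.9–IV.1.11, IV.2.3, V.3.13] [cite: Rogawski1990, §13.9 (ii) p. 229]
[cite: WeilIntegration1965, §9] -/
theorem resGMidBlockτ_le_residual_of_record_framed
    (μ : Measure (quasiSplit (↥(maximalRealSubfield L)) L (IsCMField.complexConj L) 3).automorphicQuotient) [(quasiSplit (↥(maximalRealSubfield L)) L (IsCMField.complexConj L) 3).IsAutomorphicMeasure μ]
    (𝔓 : (quasiSplit (↥(maximalRealSubfield L)) L (IsCMField.complexConj L) 3).ParabolicUnipotentData) (h𝔓 : ∀ j : 𝔓.ι, 𝔓.radical j = adelicUnipotent (↥(maximalRealSubfield L)) L (IsCMField.complexConj L) 3) (hne : Nonempty 𝔓.ι)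
    (μω : HeckeCharacter L) (hμu : μω.IsUnitary) (hquad : (∀ x : Literature.NumberTheory.GaloisRepresentations.ideleGroup ↥(maximalRealSubfield L), μω (AdeleRing.ideleBaseChange (↥(maximalRealSubfield L)) L x) = quadraticHeckeCharCM L x)) (ξ : OneDimAutRepH L)
    -- L1 at the frame
    -- L1 at the frame
    (hDISC : ∀ (E : Submodule ℂ (resGMidBlock L μ ξ μω).toSubmodule)
          (hE : ∀ k, ∀ x ∈ E, ((resGMidBlock L μ ξ μω).toContRep.restrict (((standardMaximalCompactGL 3 L).comap (adelicVal (↥(maximalRealSubfield L)) L (IsCMField.complexConj L) 3 ((StdForm.antidiagonal 3).over L)) : Subgroup (quasiSplit (↥(maximalRealSubfield L)) L (IsCMField.complexConj L) 3).Adelic)).subtype) k x ∈ E), FiniteDimensional ℂ E →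
          (((resGMidBlock L μ ξ μω).toContRep.restrict (((standardMaximalCompactGL 3 L).comap (adelicVal (↥(maximalRealSubfield L)) L (IsCMField.complexConj L) 3 ((StdForm.antidiagonal 3).over L)) : Subgroup (quasiSplit (↥(maximalRealSubfield L)) L (IsCMField.complexConj L) 3).Adelic)).subtype).subRep E hE).IsIrreducible →
          FiniteDimensional ℂ (Representation.homRangeSum ((resGMidBlock L μ ξ μω).toContRep.restrict (((standardMaximalCompactGL 3 L).comap (adelicVal (↥(maximalRealSubfield L)) L (IsCMField.complexConj L) 3 ((StdForm.antidiagonal 3).over L)) : Subgroup (quasiSplit (↥(maximalRealSubfield L)) L (IsCMField.complexConj L) 3).Adelic)).subtype).toRepresentation (((resGMidBlock L μ ξ μω).toContRep.restrict (((standardMaximalCompactGL 3 L).comap (adelicVal (↥(maximalRealSubfield L)) L (IsCMField.complexConj L) 3 ((StdForm.antidiagonal 3).over L)) : Subgroup (quasiSplit (↥(maximalRealSubfield L)) L (IsCMField.complexConj L) 3).Adelic)).subtype).subRep E hE)))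
    -- (V) (iii): the F5 scalar rows at `φ := ξ.bcη⁻¹ * μω`, `η := 1`, ONCE
    {S : Set (HeightOneSpectrum (𝓞 L))} {T' : Set (HeightOneSpectrum (𝓞 ↥(maximalRealSubfield L)))}
    (hS : S.Finite) (hurφ : ∀ w ∉ S, (ξ.bcη⁻¹ * μω).IsUnramifiedAt w) (hT' : T'.Finite) (hurη : ∀ v ∉ T', (1 : HeckeCharacter ↥(maximalRealSubfield L)).IsUnramifiedAt v)
    (q qc : ℂ → ℂ) {P : Set ℂ} (hqcq : ∀ z : ℂ, 2 < z.re → qc z = q z) (hPcd : ∀ z₀ : ℂ, ∀ᶠ s in 𝓝[≠] z₀, s ∉ P) (hqa : ∀ z : ℂ, z ∉ P → AnalyticAt ℂ qc z)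
    (A : ℂ → ℂ) (hA : DifferentiableOn ℂ A {z : ℂ | 1 < z.re})
    (hsrc : ∀ z : ℂ, 2 < z.re → q z = A z *
          ((partialStandardL S (fun w => {(ξ.bcη⁻¹ * μω).valueAtUniformizer w}) (z - 1) * partialStandardL T' (fun v => {(1 : HeckeCharacter ↥(maximalRealSubfield L)).valueAtUniformizer v}) (2 * z - 2)) /
            (partialStandardL S (fun w => {(ξ.bcη⁻¹ * μω).valueAtUniformizer w}) z * partialStandardL T' (fun v => {(1 : HeckeCharacter ↥(maximalRealSubfield L)).valueAtUniformizer v}) (2 * z - 1))))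
    (hA32 : A (3 / 2) ≠ 0)
    -- PER τ-GENERATOR: the UNFOLDING letter (W1)
    (hUNF :
      ∀ (U₀ : Subgroup ↥(finAdelic (↥(maximalRealSubfield L)) L (IsCMField.complexConj L) 3 ((StdForm.antidiagonal 3).over L))) (_ : IsTauLevel L U₀)
      (φ : (quasiSplit (↥(maximalRealSubfield L)) L (IsCMField.complexConj L) 3).Adelic → ℂ) (_ : φ ∈ chiSectionSpacePair (ξ.bcη⁻¹ * ξ.bcψ⁻¹ * μω) ξ.ψ (tauLevel L U₀) ((1 : ↥(tauLevel L U₀) →* ℂ) : ↥(tauLevel L U₀) → ℂ)) (_ : Continuous φ)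
      (_ : IsArchFinite L φ)
      (Ec : ℂ → (quasiSplit (↥(maximalRealSubfield L)) L (IsCMField.complexConj L) 3).Adelic → ℂ) (Sp : Finset ℂ) (_ : ∀ s ∈ Sp, s.im = 0 ∧ 1 < s.re ∧ s.re ≤ 2)
      (_ : ∀ g, DifferentiableOn ℂ (fun z => Ec z g) ({z : ℂ | 1 < z.re} \ (↑Sp : Set ℂ)))
      (_ : ∀ z : ℂ, 2 < z.re → Ec z = eisensteinSeriesU (flatSectionU φ z))
      (Fp : (quasiSplit (↥(maximalRealSubfield L)) L (IsCMField.complexConj L) 3).Adelic → ℂ → ℂ) (_ : ∀ g, AnalyticAt ℂ (Fp g) ((3 : ℂ) / 2))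
      (_ : ∀ g, Fp g =ᶠ[𝓝[≠] ((3 : ℂ) / 2)] fun z => (z - (3 : ℂ) / 2) * Ec z g)
      (f : (quasiSplit (↥(maximalRealSubfield L)) L (IsCMField.complexConj L) 3).L2 μ) (_ : (f : (quasiSplit (↥(maximalRealSubfield L)) L (IsCMField.complexConj L) 3).automorphicQuotient → ℂ) =ᵐ[μ] fun x => Fp (Quotient.out (x : (quasiSplit (↥(maximalRealSubfield L)) L (IsCMField.complexConj L) 3).Adelic ⧸ (quasiSplit (↥(maximalRealSubfield L)) L (IsCMField.complexConj L) 3).quotientSubgroup))⁻¹ ((3 : ℂ) / 2))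
      (ν : Measure ↥(adelicUnipotent (↥(maximalRealSubfield L)) L (IsCMField.complexConj L) 3)) (_ : ν.IsHaarMeasure) (𝓕 : Set ↥(adelicUnipotent (↥(maximalRealSubfield L)) L (IsCMField.complexConj L) 3)) (_ : IsFundamentalDomain ↥(rationalUnipotent (↥(maximalRealSubfield L)) L (IsCMField.complexConj L) 3) 𝓕 ν) (_ : IsCompact (closure 𝓕)) (_ : ν.IsInvInvariant) (_ : ν 𝓕 = 1),
      ∃ (Ag : (quasiSplit (↥(maximalRealSubfield L)) L (IsCMField.complexConj L) 3).Adelic → ℂ → ℂ) (M : ℝ),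
        (∀ g, DifferentiableOn ℂ (Ag g) {z : ℂ | 1 < z.re}) ∧ (∀ g, ‖Ag g (3 / 2)‖ ≤ M) ∧
        (∀ z : ℂ, 2 < z.re → ∀ g : (quasiSplit (↥(maximalRealSubfield L)) L (IsCMField.complexConj L) 3).Adelic, (borelConstantTerm ν 𝓕 (Ec z) g - φ g * (((borelHeight g : ℝ≥0) : ℝ) : ℂ) ^ z) / (((borelHeight g : ℝ≥0) : ℝ) : ℂ) ^ (2 - z) = Ag g z *
          ((partialStandardL S (fun w => {(ξ.bcη⁻¹ * μω).valueAtUniformizer w}) (z - 1) * partialStandardL T' (fun v => {(1 : HeckeCharacter ↥(maximalRealSubfield L)).valueAtUniformizer v}) (2 * z - 2)) /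
            (partialStandardL S (fun w => {(ξ.bcη⁻¹ * μω).valueAtUniformizer w}) z * partialStandardL T' (fun v => {(1 : HeckeCharacter ↥(maximalRealSubfield L)).valueAtUniformizer v}) (2 * z - 1)))))
    -- PER τ-ADMISSIBLE SECTION: the per-base-point Euler factorisation on `K_max` AT THE SCALAR OF RECORD (W1)
    (hunfK :
      ∀ (U₀ : Subgroup ↥(finAdelic (↥(maximalRealSubfield L)) L (IsCMField.complexConj L) 3 ((StdForm.antidiagonal 3).over L))) (_ : IsTauLevel L U₀)
      (φ : (quasiSplit (↥(maximalRealSubfield L)) L (IsCMField.complexConj L) 3).Adelic → ℂ) (_ : φ ∈ chiSectionSpacePair (ξ.bcη⁻¹ * ξ.bcψ⁻¹ * μω) ξ.ψ (tauLevel L U₀) ((1 : ↥(tauLevel L U₀) →* ℂ) : ↥(tauLevel L U₀) → ℂ)) (_ : Continuous φ)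
      (_ : IsArchFinite L φ)
      (ν : Measure ↥(adelicUnipotent (↥(maximalRealSubfield L)) L (IsCMField.complexConj L) 3)) (_ : ν.IsHaarMeasure) (𝓕 : Set ↥(adelicUnipotent (↥(maximalRealSubfield L)) L (IsCMField.complexConj L) 3)) (_ : IsFundamentalDomain ↥(rationalUnipotent (↥(maximalRealSubfield L)) L (IsCMField.complexConj L) 3) 𝓕 ν) (_ : IsCompact (closure 𝓕)) (_ : ν.IsInvInvariant) (_ : ν 𝓕 = 1),
      ∀ k : (quasiSplit (↥(maximalRealSubfield L)) L (IsCMField.complexConj L) 3).Adelic, adelicVal (↥(maximalRealSubfield L)) L (IsCMField.complexConj L) 3 ((StdForm.antidiagonal 3).over L) k ∈ standardMaximalCompactGL 3 L →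
        ∃ A' : ℂ → ℂ, DifferentiableOn ℂ A' {z : ℂ | 1 < z.re} ∧ ∀ z : ℂ, 2 < z.re →
          (∫ v : ↥(adelicUnipotent (↥(maximalRealSubfield L)) L (IsCMField.complexConj L) 3), flatSectionU φ z ((quasiSplit (↥(maximalRealSubfield L)) L (IsCMField.complexConj L) 3).toAdelic (weylLongU ((IsCMField.complexConj L : L ≃ₐ[↥(maximalRealSubfield L)] L) : L →+* L) (rfl : (StdForm.antidiagonal 3).over L = (StdForm.antidiagonal 3).over L)) * ((v : (quasiSplit (↥(maximalRealSubfield L)) L (IsCMField.complexConj L) 3).Adelic) * k)) ∂ν) =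
            ((partialStandardL S (fun w => {(ξ.bcη⁻¹ * μω).valueAtUniformizer w}) (z - 1) * partialStandardL T' (fun v => {(1 : HeckeCharacter ↥(maximalRealSubfield L)).valueAtUniformizer v}) (2 * z - 2)) / (partialStandardL S (fun w => {(ξ.bcη⁻¹ * μω).valueAtUniformizer w}) z * partialStandardL T' (fun v => {(1 : HeckeCharacter ↥(maximalRealSubfield L)).valueAtUniformizer v}) (2 * z - 1))) * A' z)
    -- PER τ-ADMISSIBLE SECTION: OFF-AXIS BOUNDEDNESS of the continued coordinates in `{1 < Re}` (★ p865213 §3's binder, K2E3-p29 FILE 2 pays it) [MW95 IV.1.11]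
    (hOFFBD : ∀ (U₀ : Subgroup ↥(finAdelic (↥(maximalRealSubfield L)) L (IsCMField.complexConj L) 3 ((StdForm.antidiagonal 3).over L))) (_ : IsTauLevel L U₀)
      (φ : (quasiSplit (↥(maximalRealSubfield L)) L (IsCMField.complexConj L) 3).Adelic → ℂ) (_ : φ ∈ chiSectionSpacePair (ξ.bcη⁻¹ * ξ.bcψ⁻¹ * μω) ξ.ψ (tauLevel L U₀) ((1 : ↥(tauLevel L U₀) →* ℂ) : ↥(tauLevel L U₀) → ℂ)) (_ : Continuous φ)
      (_ : IsArchFinite L φ)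
      (ν : Measure ↥(adelicUnipotent (↥(maximalRealSubfield L)) L (IsCMField.complexConj L) 3)) (_ : ν.IsHaarMeasure) (𝓕 : Set ↥(adelicUnipotent (↥(maximalRealSubfield L)) L (IsCMField.complexConj L) 3))
      (_ : IsFundamentalDomain ↥(rationalUnipotent (↥(maximalRealSubfield L)) L (IsCMField.complexConj L) 3) 𝓕 ν) (_ : IsCompact (closure 𝓕)) (_ : ν.IsInvInvariant) (_ : ν 𝓕 = 1),
      ∀ (ι : Type) [Fintype ι] (φ' : ι → (quasiSplit (↥(maximalRealSubfield L)) L (IsCMField.complexConj L) 3).Adelic → ℂ) (qv qcv : ι → ℂ → ℂ) (Pv : Set ℂ),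
        LinearIndependent ℂ φ' →
        (∀ j, IsChiSectionPair (reflectChar (IsCMField.complexConj L) (ξ.bcη⁻¹ * ξ.bcψ⁻¹ * μω)) ξ.ψ (φ' j)) →
        (∀ j, Continuous (φ' j)) →
        (∀ j, ∃ C : ℝ, ∀ x, ‖φ' j x‖ ≤ C) →
        (∀ z : ℂ, 2 < z.re → (∑ j, qv j z • φ' j) = ((((ν 𝓕).toReal⁻¹ : ℝ)) : ℂ) • (fun g : (quasiSplit (↥(maximalRealSubfield L)) L (IsCMField.complexConj L) 3).Adelic => (∫ v : ↥(adelicUnipotent (↥(maximalRealSubfield L)) L (IsCMField.complexConj L) 3), flatSectionU φ z ((quasiSplit (↥(maximalRealSubfield L)) L (IsCMField.complexConj L) 3).toAdelic (weylLongU ((IsCMField.complexConj L : L ≃ₐ[↥(maximalRealSubfield L)] L) : L →+* L) (rfl : (StdForm.antidiagonal 3).over L = (StdForm.antidiagonal 3).over L)) * ((v : (quasiSplit (↥(maximalRealSubfield L)) L (IsCMField.complexConj L) 3).Adelic) * g)) ∂ν) * (((borelHeight g : ℝ) : ℂ) ^ (z - 2)))) →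
        (∀ z₀ : ℂ, ∀ᶠ s in 𝓝[≠] z₀, s ∉ Pv) →
        (∀ z ∈ Pv, z.re ≤ 2) →
        (∀ j (z : ℂ), z ∉ Pv → AnalyticAt ℂ (qcv j) z) →
        (∀ j (z : ℂ), 2 < z.re → qcv j z = qv j z) →
        (∀ j, MeromorphicNFOn (qcv j) univ) →
      ∀ z₀ : ℂ, 1 < z₀.re → z₀.im ≠ 0 → ∃ C : ℝ, ∀ᶠ z in 𝓝[≠] z₀, ∀ j, ‖qcv j z‖ ≤ C) :
    resGMidBlockτ L μ ξ μω ≤ residualSubspace (quasiSplit (↥(maximalRealSubfield L)) L (IsCMField.complexConj L) 3) μ 𝔓 := by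
  -- F1′: Borel σ-algebras on `G_∞`, `G_f` and the ideles
  letI : MeasurableSpace ↥(arch (↥(maximalRealSubfield L)) L (IsCMField.complexConj L) 3 ((StdForm.antidiagonal 3).over L)) := borel _
  haveI : BorelSpace ↥(arch (↥(maximalRealSubfield L)) L (IsCMField.complexConj L) 3 ((StdForm.antidiagonal 3).over L)) := ⟨rfl⟩
  letI : MeasurableSpace ↥(finAdelic (↥(maximalRealSubfield L)) L (IsCMField.complexConj L) 3 ((StdForm.antidiagonal 3).over L)) := borel _
  haveI : BorelSpace ↥(finAdelic (↥(maximalRealSubfield L)) L (IsCMField.complexConj L) 3 ((StdForm.antidiagonal 3).over L)) := ⟨rfl⟩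
  letI : MeasurableSpace (AdeleRing (𝓞 L) L)ˣ := borel _
  haveI : BorelSpace (AdeleRing (𝓞 L) L)ˣ := ⟨rfl⟩
  -- F3: the `G`-side structural cluster `νG β μZ` (★ one-shot package)
  obtain ⟨νG, β, μZ, hH, -, hI, hS', hβ, hSZ, hμZ⟩ := exists_haar_coveringWeight_unfoldedMeasure_cm_three L
  haveI := hH
  haveI := hI
  haveI := hS'
  haveI := hSZ
  -- F4: the Heisenberg cluster `νE 𝓕E` (★ one-shot package; pure frame here)
  obtain ⟨νE, 𝓕E, hEH, hER, hEI, h𝓕EN, h𝓕Ec, h𝓕E0, -⟩ := exists_unipotent_haar_fundamentalDomain_cm_three L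
  haveI := hEH
  haveI := hER
  haveI := hEI
  -- instance preamble for the Haar choices
  haveI := t2Space_adeleRing_of_numberField L
  haveI := locallyCompactSpace_adeleRing' L
  haveI : LocallyCompactSpace ↥(finAdelic (↥(maximalRealSubfield L)) L (IsCMField.complexConj L) 3 ((StdForm.antidiagonal 3).over L)) :=
    locallyCompactSpace_finAdelic (↥(maximalRealSubfield L)) L (IsCMField.complexConj L) 3 ((StdForm.antidiagonal 3).over L)
  -- F5 F6: the port Haar measures
  set μa : Measure ↥(arch (↥(maximalRealSubfield L)) L (IsCMField.complexConj L) 3 ((StdForm.antidiagonal 3).over L)) := Measure.haar with hμa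
  haveI : μa.IsMulRightInvariant :=
    isMulRightInvariant_of_modularCharacterFun_eq_one (modularCharacterFun_arch_eq_one L ((StdForm.antidiagonal 3).over L) (cmConj_antidiagonal_transpose L (N := 3)) (isUnit_det_antidiagonal_over L (N := 3)).ne_zero) μa
  set μf : Measure ↥(finAdelic (↥(maximalRealSubfield L)) L (IsCMField.complexConj L) 3 ((StdForm.antidiagonal 3).over L)) := Measure.haar with hμf
  -- ED. 4
  exact resGMidBlockτ_le_residual_of_record_v4 L μ 𝔓 h𝔓 hne μω hμu hquad ξ hDISC νG νE h𝓕EN h𝓕Ec h𝓕E0 hβ hμZ μa μf hS hurφ hT' hurη q qc hqcq hPcd hqa A hA hsrc hA32 hUNF hunfK hOFFBD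

end Summit.HodgeConjecture.HodgeConjecture.R90.S8

end
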